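import Literature.Probability.RandomPlanarGeometry.SelfAvoidingWalk
import Literature.Probability.RandomPlanarGeometry.PolylineUniform
import Literature.Probability.RandomPlanarGeometry.SimpleCurves
import Literature.Probability.Percolation.LatticePathArcs
import Summits.CriticalPhenomena.SAWScalingLimit.Theorems.SAWTotalPositivityTPToTraversalBoundBoundaryShellsAux
import HarnessLib

/-!
# Route `SAWReversalUpgrade`, support `FaithfulOfNoReturn` (stmt-CriticalPhenomena-18008):
# the mesh polyline of a self-avoiding walk is a flat curve

Helper file (10 of several) for the proof of
`Summit.CriticalPhenomena.SAWScalingLimit.Theses.SAWReversalUpgrade.FaithfulOfNoReturn`.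

The tree's polyline `γ.walk.toCurve (meshPoint δ)` of a SAW `γ` of `Ω_δ ⊆ δℤ²` runs through the
mesh points with the dyadic `Path.trans` clock; by `Polyline.polyline_apply_eq_uniform_clock` it is
the uniform parametrisation `U` run with the monotone clock. We prove:

* `uniform_param_eq` / `injOn_uniform_saw` — **`U` is injective on `[0, |γ|]`**: two distinct unit
  edges of `ℤ²` meet only at a common endpoint (`exists_eq_toComplex_of_mem_edgeTrace_inter`) and a
  self-avoiding walk repeats no vertex;
* `isFlat_toCurve` — hence the dyadic polyline is FLAT (`Curve.IsFlat`: equal values at `s ≤ t` force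
  constancy on `[s, t]`), the only input about `P` the faithfulness estimate needs;
* the endpoint/closure facts `toCurve_mem_closure'`, `meshPoint_fst_mem`, `meshPoint_snd_mem`.
-/

noncomputable section

open Set Function
open scoped unitInterval
open Literature.Probability.RandomPlanarGeometry Literature.Probability.LatticeModels
  Literature.Probability.Percolation Literature.Probability.RandomPlanarGeometry.Polyline

namespace Summit.CriticalPhenomena.SAWScalingLimit.Theorems

namespace FaithfulAttach

variable {Ω : Set ℂ} {δ : ℝ} {x y : Site 2}

/-! ### Lattice edges in the plane -/

/-- `Site.toComplex` is injective. -/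
theorem toComplex_injective : Injective (Site.toComplex : Site 2 → ℂ) := by
  intro v w h
  have h0 := congrArg Complex.re h
  have h1 := congrArg Complex.im h
  simp only [Site.toComplex_re, Site.toComplex_im, Int.cast_inj] at h0 h1
  funext i
  fin_cases i
  · exact h0
  · exact h1

/-- `lineMap` on scaled points: `lineMap (δa) (δb) c = δ · lineMap a b c`. -/
theorem lineMap_mul (δ : ℂ) (a b : ℂ) (c : ℝ) :
    AffineMap.lineMap (δ * a) (δ * b) c = δ * AffineMap.lineMap a b c := by
  simp only [AffineMap.lineMap_apply_module, Complex.real_smul]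
  ring

/-- `lineMap a b c ∈ segment a b` for `c ∈ [0, 1]`. -/
theorem lineMap_mem_segment' (a b : ℂ) {c : ℝ} (hc : c ∈ Icc (0:ℝ) 1) :
    AffineMap.lineMap a b c ∈ segment ℝ a b := by
  rw [segment_eq_image_lineMap]
  exact ⟨c, hc, rfl⟩

/-- For `a ≠ b`, `c ↦ lineMap a b c` is injective. -/
theorem lineMap_injective' {a b : ℂ} (hab : a ≠ b) : Injective fun c : ℝ => AffineMap.lineMap a b c := by
  intro c c' h
  simp only [AffineMap.lineMap_apply_module'] at h
  have hd : b - a ≠ 0 := sub_ne_zero.2 (Ne.symm hab)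
  exact smul_left_injective ℝ hd (add_right_cancel h)

/-- `lineMap a b c = b` with `a ≠ b` forces `c = 1`. -/
theorem eq_one_of_lineMap_eq_right {a b : ℂ} (hab : a ≠ b) {c : ℝ} (h : AffineMap.lineMap a b c = b) :
    c = 1 :=
  lineMap_injective' hab (by
    show AffineMap.lineMap a b c = AffineMap.lineMap a b 1
    rw [h, AffineMap.lineMap_apply_one])

/-- `lineMap a b c = a` with `a ≠ b` forces `c = 0`. -/
theorem eq_zero_of_lineMap_eq_left {a b : ℂ} (hab : a ≠ b) {c : ℝ} (h : AffineMap.lineMap a b c = a) :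
    c = 0 :=
  lineMap_injective' hab (by
    show AffineMap.lineMap a b c = AffineMap.lineMap a b 0
    rw [h, AffineMap.lineMap_apply_zero])

/-! ### The uniform parametrisation of a SAW is injective on `[0, |γ|]` -/

section Uniform

variable (γ : SAW.DomainSAW Ω δ x y)

/-- Consecutive vertices of a walk of `Ω_δ` are adjacent in `ℤ²`. -/
theorem adj_zd_getVert {i : ℕ} (hi : i < γ.walk.length) :
    (zdGraph 2).Adj (γ.walk.getVert i) (γ.walk.getVert (i + 1)) :=
  meshGraph_le_zdGraph Ω δ (discreteDomainGraph_le_meshGraph Ω δ (γ.walk.adj_getVert_succ hi))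

/-- The `k`-th point of the mesh-point list of the walk is the mesh point of the `k`-th vertex. -/
theorem map_support_getElem {k : ℕ} (hk : k ≤ γ.walk.length) :
    (γ.walk.support.map (meshPoint δ))[k]'(by
      rw [List.length_map, SimpleGraph.Walk.length_support]; omega) =
      meshPoint δ (γ.walk.getVert k) := by
  rw [List.getElem_map, γ.walk.getVert_eq_support_getElem hk]

/-- **Segmentwise formula for the uniform parametrisation of a SAW**: during `[i, i+1]` it traverses
the `i`-th mesh edge affinely. -/
theorem uniform_saw_apply_add {i : ℕ} (hi : i < γ.walk.length) {c : ℝ} (hc : c ∈ Icc (0:ℝ) 1) :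
    uniform ((γ.walk.support.map (meshPoint δ)).head (by simp))
      (γ.walk.support.map (meshPoint δ)).tail (i + c) =
      (δ : ℂ) * AffineMap.lineMap (Site.toComplex (γ.walk.getVert i))
        (Site.toComplex (γ.walk.getVert (i + 1))) c := by
  have hlen : i + 1 < (γ.walk.support.map (meshPoint δ)).length := by
    rw [List.length_map, SimpleGraph.Walk.length_support]; omega
  rw [uniform_head_tail_apply_add _ (by simp) i hlen hc, map_support_getElem γ hi.le,
    map_support_getElem γ hi]
  exact lineMap_mul _ _ _ _

/-- **Two-index injectivity**: if `U (i + c) = U (i' + c')` for segment indices `i ≤ i'` and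
parameters `c, c' ∈ [0, 1]`, then `i + c = i' + c'` (distinct lattice edges meet only at a common
endpoint; a SAW repeats no vertex). -/
theorem uniform_param_eq (hδ : δ ≠ 0) {i i' : ℕ} (hi : i < γ.walk.length) (hi' : i' < γ.walk.length)
    (hii' : i ≤ i') {c c' : ℝ} (hc : c ∈ Icc (0:ℝ) 1) (hc' : c' ∈ Icc (0:ℝ) 1)
    (h : uniform ((γ.walk.support.map (meshPoint δ)).head (by simp))
        (γ.walk.support.map (meshPoint δ)).tail (i + c) =
      uniform ((γ.walk.support.map (meshPoint δ)).head (by simp))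
        (γ.walk.support.map (meshPoint δ)).tail (i' + c')) :
    (i : ℝ) + c = i' + c' := by
  set V : ℕ → Site 2 := γ.walk.getVert with hV
  rw [uniform_saw_apply_add γ hi hc, uniform_saw_apply_add γ hi' hc'] at h
  have hz : AffineMap.lineMap (Site.toComplex (V i)) (Site.toComplex (V (i + 1))) c =
      AffineMap.lineMap (Site.toComplex (V i')) (Site.toComplex (V (i' + 1))) c' :=
    mul_left_cancel₀ (Complex.ofReal_ne_zero.2 hδ) h
  have hinj := γ.isPath.getVert_injOn
  have hne : ∀ {k : ℕ}, k < γ.walk.length → Site.toComplex (V k) ≠ Site.toComplex (V (k + 1)) :=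
    fun hk hk' => (adj_zd_getVert γ hk).ne (toComplex_injective hk')
  rcases hii'.eq_or_lt with rfl | hlt
  · -- same segment: the affine parametrisation is injective
    have := lineMap_injective' (hne hi) hz
    rw [this]
  · -- different segments: the common point is a common lattice endpoint
    set z := AffineMap.lineMap (Site.toComplex (V i)) (Site.toComplex (V (i + 1))) c with hzdef
    have hzmem : z ∈ edgeTrace s(V i, V (i + 1)) := by
      rw [edgeTrace_mk]; exact lineMap_mem_segment' _ _ hc
    have hzmem' : z ∈ edgeTrace s(V i', V (i' + 1)) := by
      rw [hz, edgeTrace_mk]; exact lineMap_mem_segment' _ _ hc'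
    have he : s(V i, V (i + 1)) ∈ (zdGraph 2).edgeSet := (SimpleGraph.mem_edgeSet _).2 (adj_zd_getVert γ hi)
    have he' : s(V i', V (i' + 1)) ∈ (zdGraph 2).edgeSet :=
      (SimpleGraph.mem_edgeSet _).2 (adj_zd_getVert γ hi')
    -- vertex indices are injective on `{k ≤ length}`
    have hidx : ∀ {p q : ℕ}, p ≤ γ.walk.length → q ≤ γ.walk.length → V p = V q → p = q :=
      fun hp hq hpq => hinj hp hq hpq
    have hdiff : s(V i, V (i + 1)) ≠ s(V i', V (i' + 1)) := by
      intro heq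
      rcases Sym2.eq_iff.1 heq with ⟨h1, -⟩ | ⟨h1, -⟩
      · exact absurd (hidx hi.le hi'.le h1) hlt.ne
      · have := hidx hi.le (by omega) h1
        omega
    obtain ⟨w, hw, hw1, hw2⟩ := exists_eq_toComplex_of_mem_edgeTrace_inter he he' hdiff hzmem hzmem'
    rcases Sym2.mem_iff.1 hw1 with rfl | rfl
    · -- `w = V i`: impossible since `i < i'`
      rcases Sym2.mem_iff.1 hw2 with h2 | h2
      · exact absurd (hidx hi.le hi'.le h2) hlt.ne
      · have := hidx hi.le (by omega) h2
        omega
    · -- `w = V (i+1)`: then `i' = i + 1`, `c = 1`, `c' = 0`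
      rcases Sym2.mem_iff.1 hw2 with h2 | h2
      · have hi'eq : i' = i + 1 := (hidx (by omega) hi'.le h2).symm
        subst hi'eq
        have hc1 : c = 1 := eq_one_of_lineMap_eq_right (hne hi) (hzdef.symm.trans hw)
        have hc0 : c' = 0 := by
          refine eq_zero_of_lineMap_eq_left (hne hi') ?_
          rw [← hz]
          exact hw
        rw [hc1, hc0]
        push_cast
        ring
      · have := hidx (by omega) (by omega) h2
        omega

/-- **The uniform parametrisation of a SAW is injective on `[0, |γ|]`.** -/
theorem injOn_uniform_saw (hδ : δ ≠ 0) :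
    InjOn (uniform ((γ.walk.support.map (meshPoint δ)).head (by simp))
      (γ.walk.support.map (meshPoint δ)).tail) (Icc 0 (γ.walk.length : ℝ)) := by
  -- decompose a time of `[0, n]` as `i + c` with `i < n`, `c ∈ [0, 1]` (for `n ≥ 1`)
  have hdec : ∀ s ∈ Icc (0:ℝ) (γ.walk.length : ℝ), 0 < γ.walk.length →
      ∃ i : ℕ, i < γ.walk.length ∧ ∃ c ∈ Icc (0:ℝ) 1, s = i + c := by
    intro s hs hn
    set i : ℕ := min ⌊s⌋₊ (γ.walk.length - 1) with hi
    have hile : i ≤ ⌊s⌋₊ := min_le_left _ _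
    have hfloor : (⌊s⌋₊ : ℝ) ≤ s := Nat.floor_le hs.1
    refine ⟨i, by omega, s - i, ⟨?_, ?_⟩, by ring⟩
    · have : (i : ℝ) ≤ ⌊s⌋₊ := by exact_mod_cast hile
      linarith
    · by_cases h : ⌊s⌋₊ ≤ γ.walk.length - 1
      · have hieq : i = ⌊s⌋₊ := min_eq_left h
        rw [hieq]
        linarith [Nat.lt_floor_add_one s]
      · have hieq : i = γ.walk.length - 1 := min_eq_right (by omega)
        have : ((γ.walk.length - 1 : ℕ) : ℝ) = γ.walk.length - 1 := by
          rw [Nat.cast_sub (by omega)]; simp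
        rw [hieq, this]
        linarith [hs.2]
  intro s hs t ht hst
  rcases Nat.eq_zero_or_pos γ.walk.length with h0 | hn
  · -- no step: the interval is `{0}`
    rw [h0, Nat.cast_zero] at hs ht
    exact (le_antisymm hs.2 hs.1).trans (le_antisymm ht.2 ht.1).symm
  obtain ⟨i, hi, c, hc, rfl⟩ := hdec s hs hn
  obtain ⟨i', hi', c', hc', rfl⟩ := hdec t ht hn
  rcases le_total i i' with hle | hle
  · exact uniform_param_eq γ hδ hi hi' hle hc hc' hst
  · exact (uniform_param_eq γ hδ hi' hi hle hc' hc hst.symm).symm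

end Uniform

/-! ### Flatness of the dyadic polyline -/

/-- **The mesh polyline of a SAW is flat.** -/
theorem isFlat_toCurve (γ : SAW.DomainSAW Ω δ x y) (hδ : δ ≠ 0) :
    (⟨γ.walk.toCurve (meshPoint δ)⟩ : Curve ℂ).IsFlat := by
  -- the polyline is the uniform parametrisation run with the dyadic clock
  have hsupp : γ.walk.support.map (meshPoint δ) =
      (γ.walk.support.map (meshPoint δ)).head (by simp) :: (γ.walk.support.map (meshPoint δ)).tail :=
    (List.cons_head_tail (by simp)).symm
  have hlen : (γ.walk.support.map (meshPoint δ)).tail.length = γ.walk.length := by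
    rw [List.length_tail, List.length_map, SimpleGraph.Walk.length_support]; rfl
  have hP : ∀ t : I, γ.walk.toCurve (meshPoint δ) t =
      uniform ((γ.walk.support.map (meshPoint δ)).head (by simp)) (γ.walk.support.map (meshPoint δ)).tail
        (clock γ.walk.length t) := by
    intro t
    change polyline (γ.walk.support.map (meshPoint δ)) t = _
    conv_lhs => rw [hsupp]
    rw [polyline_apply_eq_uniform_clock, hlen]
  intro s u t hsu hut hst
  change γ.walk.toCurve (meshPoint δ) u = γ.walk.toCurve (meshPoint δ) s
  change γ.walk.toCurve (meshPoint δ) s = γ.walk.toCurve (meshPoint δ) t at hst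
  rw [hP, hP] at hst ⊢
  have hcs := clock_mem_Icc γ.walk.length s.2
  have hct := clock_mem_Icc γ.walk.length t.2
  have heq := injOn_uniform_saw γ hδ hcs hct hst
  have h1 : clock γ.walk.length s ≤ clock γ.walk.length u := monotone_clock _ hsu
  have h2 : clock γ.walk.length u ≤ clock γ.walk.length t := monotone_clock _ hut
  rw [le_antisymm (heq ▸ h2) h1]

/-! ### Endpoints and the ambient closure -/

/-- If the two lattice endpoints differ, the SAW has at least one step. -/
theorem length_pos_of_ne (γ : SAW.DomainSAW Ω δ x y) (hxy : x ≠ y) : 0 < γ.walk.length := by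
  rcases Nat.eq_zero_or_pos γ.walk.length with h | h
  · exact absurd (SimpleGraph.Walk.eq_of_length_eq_zero h) hxy
  · exact h

/-- The mesh polyline of a SAW with distinct endpoints lies in `closure Ω`. -/
theorem toCurve_mem_closure' (γ : SAW.DomainSAW Ω δ x y) (hxy : x ≠ y) (t : I) :
    γ.walk.toCurve (meshPoint δ) t ∈ closure Ω :=
  TPToTraversalBound.Radial.toCurve_mem_closure γ (length_pos_of_ne γ hxy) t

/-- The starting mesh point of a SAW with distinct endpoints lies in `Ω`. -/
theorem meshPoint_fst_mem (γ : SAW.DomainSAW Ω δ x y) (hxy : x ≠ y) : meshPoint δ x ∈ Ω := by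
  have h := meshDomain_subset_meshVertices Ω δ
    (TPToTraversalBound.Radial.getVert_mem_meshDomain γ (length_pos_of_ne γ hxy) 0)
  rwa [SimpleGraph.Walk.getVert_zero] at h

/-- The final mesh point of a SAW with distinct endpoints lies in `Ω`. -/
theorem meshPoint_snd_mem (γ : SAW.DomainSAW Ω δ x y) (hxy : x ≠ y) : meshPoint δ y ∈ Ω := by
  have h := meshDomain_subset_meshVertices Ω δ
    (TPToTraversalBound.Radial.getVert_mem_meshDomain γ (length_pos_of_ne γ hxy) γ.walk.length)
  rwa [SimpleGraph.Walk.getVert_length] at h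

end FaithfulAttach

end Summit.CriticalPhenomena.SAWScalingLimit.Theorems
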